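import Literature.Geometry.Kaehler.L2FunSmulBound
import Literature.NumberTheory.Transcendental.KaehlerHodgeEllipticReductionProofs
import Mathlib.Geometry.Manifold.PartitionOfUnity
import HarnessLib

/-!
# Global gluing of local smooth representatives (Warner 6.32, "w = Σ φ_i u_{p_i}")

F. W. Warner, GTM 94 (1983), end of 6.32: once every point has a neighbourhood on which a bounded
functional `ℓ` on `A^k(M)` is represented by a smooth form, a partition of unity subordinate to a
finite subcover gives a global smooth representative `w = Σ_i φ_i u_i` with `ℓ(t) = ⟪w, t⟫` for all
smooth `t`. This file proves exactly this gluing for the complex pre-Hilbert space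
`CL2SmoothForms o k`.

## References

* F. W. Warner, GTM 94 (1983), 6.32 (last paragraph). [WarnerGTM94]
-/

noncomputable section

open scoped Manifold ContDiff Topology ComplexConjugate ComplexInnerProductSpace
open Bundle Set Function Module Filter Complex
open Literature.NumberTheory.Transcendental

namespace Literature.Geometry.Kaehler


section Glue

variable {E : Type*} [NormedAddCommGroup E] [NormedSpace ℂ E] [FiniteDimensional ℂ E]
  {n : ℕ} [Fact (finrank ℝ E = n)] [MeasurableSpace E] [BorelSpace E]
  {M : Type*} [TopologicalSpace M] [ChartedSpace E M] [T2Space M] [CompactSpace M]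
  [IsManifold 𝓘(ℝ, E) ∞ M] [RiemannianBundle (fun x : M ↦ TangentSpace 𝓘(ℝ, E) x)]
  [IsContMDiffRiemannianBundle 𝓘(ℝ, E) ∞ E (fun x : M ↦ TangentSpace 𝓘(ℝ, E) x)]
  (o : (x : M) → Orientation ℝ (TangentSpace 𝓘(ℝ, E) x) (Fin n)) {k : ℕ}
  [Fact (IsSmoothForm (riemannianVolumeForm o))]

omit [IsContMDiffRiemannianBundle 𝓘(ℝ, E) ∞ E (fun x : M ↦ TangentSpace 𝓘(ℝ, E) x)] [Fact (IsSmoothForm (riemannianVolumeForm o))] in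
/-- `⟪ρα, β⟫_{L²} = ⟪α, ρβ⟫_{L²}` for real functions `ρ` (pointwise). [folklore] -/
theorem MForm.l2Inner_fun_smul_comm (ρ : M → ℝ) (α β : MForm 𝓘(ℝ, E) M ℝ k) :
    MForm.l2Inner o (ρ • α) β = MForm.l2Inner o α (ρ • β) := by
  unfold MForm.l2Inner
  congr 1 with x
  simp only [MForm.inner, Pi.smul_apply', map_smul, LinearMap.smul_apply, smul_eq_mul]


omit [IsContMDiffRiemannianBundle 𝓘(ℝ, E) ∞ E (fun x : M ↦ TangentSpace 𝓘(ℝ, E) x)] [Fact (IsSmoothForm (riemannianVolumeForm o))] in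
/-- `⟪ρα, β⟫ = ⟪α, ρβ⟫` for the Hermitian `L²` product and real functions `ρ`. [folklore] -/
theorem MForm.cl2Inner_fun_smul_comm (ρ : M → ℝ) (α β : MForm 𝓘(ℝ, E) M ℂ k) :
    MForm.cl2Inner o (ρ • α) β = MForm.cl2Inner o α (ρ • β) := by
  simp only [MForm.cl2Inner, (MForm.re_fun_smul ρ α).1, (MForm.re_fun_smul ρ α).2, (MForm.re_fun_smul ρ β).1,
    (MForm.re_fun_smul ρ β).2, MForm.l2Inner_fun_smul_comm]


/-- `⟪mk (ρu), mk t⟫ = ⟪mk u, mk (ρt)⟫` for smooth real `ρ`. [folklore] -/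
theorem CL2SmoothForms.inner_mk_fun_smul_comm {ρ : M → ℝ} (hρ : ContMDiff 𝓘(ℝ, E) 𝓘(ℝ) ∞ ρ)
    {u t : MForm 𝓘(ℝ, E) M ℂ k} (hu : IsSmoothForm u) (ht : IsSmoothForm t) :
    ⟪CL2SmoothForms.mk o (ρ • u) (hu.fun_smul' hρ), CL2SmoothForms.mk o t ht⟫ =
      ⟪CL2SmoothForms.mk o u hu, CL2SmoothForms.mk o (ρ • t) (ht.fun_smul' hρ)⟫ := by
  rw [CL2SmoothForms.inner_mk_mk, CL2SmoothForms.inner_mk_mk, MForm.cl2Inner_fun_smul_comm]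

omit [FiniteDimensional ℂ E] [Fact (finrank ℝ E = n)] [MeasurableSpace E] [BorelSpace E] [T2Space M] [CompactSpace M]
  [IsManifold 𝓘(ℝ, E) ∞ M] [RiemannianBundle (fun x : M ↦ TangentSpace 𝓘(ℝ, E) x)]
  [IsContMDiffRiemannianBundle 𝓘(ℝ, E) ∞ E (fun x : M ↦ TangentSpace 𝓘(ℝ, E) x)] [Fact (IsSmoothForm (riemannianVolumeForm o))] in
/-- Finite sums of smooth forms are smooth. [folklore] -/
theorem isSmoothForm_finset_sum {ι : Type*} (s : Finset ι) {g : ι → MForm 𝓘(ℝ, E) M ℂ k}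
    (hg : ∀ i, IsSmoothForm (g i)) : IsSmoothForm (∑ i ∈ s, g i) := by
  classical
  induction s using Finset.induction_on with
  | empty => simpa using (isSmoothForm_zero : IsSmoothForm (0 : MForm 𝓘(ℝ, E) M ℂ k))
  | insert a s ha ih => rw [Finset.sum_insert ha]; exact (hg a).add ih

/-- `mk` of a finite sum. [folklore] -/
theorem CL2SmoothForms.mk_finset_sum {ι : Type*} (s : Finset ι) (g : ι → MForm 𝓘(ℝ, E) M ℂ k)
    (hg : ∀ i, IsSmoothForm (g i)) :
    CL2SmoothForms.mk o (∑ i ∈ s, g i) (isSmoothForm_finset_sum s hg) = ∑ i ∈ s, CL2SmoothForms.mk o (g i) (hg i) := by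
  apply (CL2SmoothForms.toForm_inj o).1
  rw [CL2SmoothForms.toForm_mk, ← CL2SmoothForms.toFormₗ_apply, map_sum]
  rfl

/-- **Gluing local representatives** (Warner 6.32, last paragraph): if every point has an open
neighbourhood on which `ℓ` is represented by a smooth form, then `ℓ(t) = ⟪w, t⟫` for a smooth
`w` and all smooth `t`. [cite: WarnerGTM94, 6.32] -/
theorem CL2SmoothForms.exists_global_repr_of_local (ℓ : CL2SmoothForms o k →L[ℂ] ℂ)
    (hloc : ∀ p : M, ∃ U : Set M, IsOpen U ∧ p ∈ U ∧ ∃ (u : MForm 𝓘(ℝ, E) M ℂ k) (hu : IsSmoothForm u),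
      ∀ (t : MForm 𝓘(ℝ, E) M ℂ k) (ht : IsSmoothForm t), (∀ x, t x ≠ 0 → x ∈ U) →
        ℓ (CL2SmoothForms.mk o t ht) = ⟪CL2SmoothForms.mk o u hu, CL2SmoothForms.mk o t ht⟫) :
    ∃ (w : MForm 𝓘(ℝ, E) M ℂ k) (hw : IsSmoothForm w), ∀ (t : MForm 𝓘(ℝ, E) M ℂ k) (ht : IsSmoothForm t),
      ℓ (CL2SmoothForms.mk o t ht) = ⟪CL2SmoothForms.mk o w hw, CL2SmoothForms.mk o t ht⟫ := by
  classical
  choose U hU hpU u hu hrep using hloc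
  -- a finite subcover and a subordinate smooth partition of unity
  obtain ⟨T, hT⟩ := isCompact_univ.elim_finite_subcover U hU fun x _ ↦ mem_iUnion.2 ⟨x, hpU x⟩
  have hcov : (univ : Set M) ⊆ ⋃ i : T, U i := fun x hx ↦ by
    obtain ⟨i, hi, hx⟩ := mem_iUnion₂.1 (hT hx)
    exact mem_iUnion.2 ⟨⟨i, hi⟩, hx⟩
  obtain ⟨f, hf⟩ := SmoothPartitionOfUnity.exists_isSubordinate (I := 𝓘(ℝ, E)) (M := M) isClosed_univ
    (fun i : T ↦ U i) (fun i ↦ hU i) hcov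
  have hfs : ∀ i, ContMDiff 𝓘(ℝ, E) 𝓘(ℝ) ∞ (f i : M → ℝ) := fun i ↦ (f i).contMDiff
  -- the global representative
  set g : T → MForm 𝓘(ℝ, E) M ℂ k := fun i ↦ (f i : M → ℝ) • u i with hg
  have hgs : ∀ i, IsSmoothForm (g i) := fun i ↦ (hu i).fun_smul' (hfs i)
  refine ⟨∑ i : T, g i, isSmoothForm_finset_sum Finset.univ hgs, fun t ht ↦ ?_⟩
  -- `t = Σ f_i t`
  have hts : ∀ i, IsSmoothForm ((f i : M → ℝ) • t) := fun i ↦ ht.fun_smul' (hfs i)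
  have hsum : ∑ i : T, (f i : M → ℝ) • t = t := by
    funext x
    have h1 : ∑ i : T, (f i : M → ℝ) x = 1 := by
      have := f.sum_eq_one (mem_univ x)
      rwa [finsum_eq_sum_of_fintype] at this
    rw [Finset.sum_apply]
    simp only [Pi.smul_apply']
    rw [← Finset.sum_smul, h1, one_smul]
  have hmk : CL2SmoothForms.mk o t ht = ∑ i : T, CL2SmoothForms.mk o ((f i : M → ℝ) • t) (hts i) := by
    rw [← CL2SmoothForms.mk_finset_sum o Finset.univ _ hts]
    exact (CL2SmoothForms.toForm_inj o).1 (by rw [CL2SmoothForms.toForm_mk, CL2SmoothForms.toForm_mk, hsum])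
  -- glue
  have hsupp : ∀ i x, ((f i : M → ℝ) • t) x ≠ 0 → x ∈ U i := fun i x hx ↦ by
    refine hf i (subset_tsupport _ fun h0 ↦ hx ?_)
    simp [Pi.smul_apply', h0]
  calc ℓ (CL2SmoothForms.mk o t ht) = ∑ i : T, ℓ (CL2SmoothForms.mk o ((f i : M → ℝ) • t) (hts i)) := by rw [hmk, map_sum]
    _ = ∑ i : T, ⟪CL2SmoothForms.mk o (u i) (hu i), CL2SmoothForms.mk o ((f i : M → ℝ) • t) (hts i)⟫ :=
        Finset.sum_congr rfl fun i _ ↦ hrep i _ (hts i) (hsupp i)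
    _ = ∑ i : T, ⟪CL2SmoothForms.mk o (g i) (hgs i), CL2SmoothForms.mk o t ht⟫ :=
        Finset.sum_congr rfl fun i _ ↦ (CL2SmoothForms.inner_mk_fun_smul_comm o (hfs i) (hu i) ht).symm
    _ = ⟪CL2SmoothForms.mk o (∑ i : T, g i) (isSmoothForm_finset_sum Finset.univ hgs), CL2SmoothForms.mk o t ht⟫ := by
        rw [CL2SmoothForms.mk_finset_sum o Finset.univ g hgs, sum_inner]

end Glue

end Literature.Geometry.Kaehler
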